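import Summits.HodgeConjecture.HodgeConjecture.Theorems.R90S6SatakeGraphPartnerOnBasis   -- ★ H1 (this seat): the STEP `satakeGraphPartner_torusGen_pow_step`
import Summits.HodgeConjecture.HodgeConjecture.Theorems.R90S6MacdonaldClosedFormU2       -- ★ F2′-U2 (this seat): `natCast_card_residueField_eq_sqrt_mul_sqrt` (`Q = q·q`)
import HarnessLib

/-!
# R90 · S6 — card H1 §3 (row E1.3.5.2.5, coefficient layer, CLOSED FORM): `ξ̂_H(φ_m) = Σ_{k ≤ m} c_{m,k} φ′_k`,
# `c_{m,m} = (−q)^m`, `c_{m,k} = (q² − 1)(−q)^k q^{2(m−1−k)}` (`k < m`) (`Theorems/R90S6SatakeGraphPartnerOnBasisClosed.lean`)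

Cell `hodgecm-mathlib`, crux H413 (`stmt-HodgeConjecture-24833`), route of record `HCCMUnconditional`; programme R90-TF, section S6 (base `R90-C14`), seat
R90-C14-p03 (g2); card H1 (dealer R90-C14-plan (g2), R90 bus 2026-09-05T00:31:44Z, cut «=» 00:35:31Z), DAG r5 row E1.3.5.2.5 «expand `ξ̂_H(φ_m) = Σ_k c_{m,k} φ′_k` in
the `U(2)` Hecke basis» — the follow-up (definition lane: ONE `def`, the explicit coefficient table `xiHCoeff`) of ★ `R90S6SatakeGraphPartnerOnBasis` (the STEP).
Helper lane `--supports stmt-HodgeConjecture-24833 --as helper`; imports = ★ H1 `R90S6SatakeGraphPartnerOnBasis` + ★ F2′-U2 `R90S6MacdonaldClosedFormU2` + HarnessLib.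

THE MATHEMATICS.  ★ H1: `ξ̂_H(φ_0) = φ′_0 = 1` and `ξ̂_H(φ_m) − Q ξ̂_H(φ_{m−1}) = (−1)^m (q^m φ′_m + q^{m−1} φ′_{m−1})` (`m ≥ 1`, `Q = #𝓀[E_w] = q²`,
`q = Nat.sqrt Q = q_v`).  Telescoping (§1, in ANY `ℂ`-module — the Hecke algebra enters only through these two identities): `ξ̂_H(φ_m) = Σ_{k ≤ m} c_{m,k} φ′_k` with
`c_{m+1,k} = q² c_{m,k}` (`k < m`), `c_{m+1,m} = q² c_{m,m} + (−1)^{m+1} q^m = (q² − 1)(−q)^m`, `c_{m+1,m+1} = (−q)^{m+1}`, solved by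
**`c_{m,m} = (−q)^m`, `c_{m,k} = (q² − 1)(−q)^k q^{2(m−1−k)}` (`k < m`)** = `xiHCoeff q m k` (§0, with its kill-checks: `ξ̂_H(φ₁) = −q φ′₁ + (q² − 1)·1`).
§2 **`satakeGraphPartnerAlgHom_doubleCosetOperator_torusGen_pow`**: the expansion in `ℋ(U(J₀,2)(E_w), K₀)` at an inert unramified place `w ∣ v`.  With p01's A1∕A1-H
(orbital integrals = displacement counts) this is the algebraic input of the H-side engine `SO^H(ξ̂_H φ_m) = Σ_k c_{m,k}·(displacement-2k counts on the (q_v+1)-regular tree)`.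
HONEST LABEL: local spherical Hecke-algebra structure; proves no printed global statement, discharges no citation; count-neutral helper until E1.3.5.2.5∕.6 consume it.
HC_CM is proved only modulo the 7 printed citations (2 remaining named inputs: hLiu418 = stmt-HodgeConjecture-24832, h413 = stmt-HodgeConjecture-24833) until rung 0 closes; REL ≠ ★ ≠ BUILT.

## References
* [Rogawski1990] J. D. Rogawski, *Automorphic Representations of Unitary Groups in Three Variables*, Ann. of Math. Stud. 123 (1990), §4.9 Prop. 4.9.1 (b), Lemma 4.9.2 pp. 55–56.
* [CartierCorvallis1979] P. Cartier, *Representations of 𝔭-adic groups: a survey*, PSPM 33.1 (1979), §IV (4.2)–(4.4), Cor. 4.2.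
* [Macdonald1971] I. G. Macdonald, *Spherical functions on a group of p-adic type*, Ramanujan Inst. Publ. 2 (1971), Ch. V §3.
-/

set_option autoImplicit false
-- the mandated namespace repeats the single-problem summit's segment (`HodgeConjecture.HodgeConjecture`)
set_option linter.dupNamespace false

noncomputable section

open scoped Valued WithZero Matrix MatrixGroups Pointwise
open MulAction ConjAct Polynomial

namespace Summit.HodgeConjecture.HodgeConjecture.R90.S6

open Literature.NumberTheory.Automorphic Literature.NumberTheory.Automorphic.HermitianLattice
  Literature.NumberTheory.Automorphic.HermitianLattice.UnramifiedLocalConjDatum Literature.NumberTheory.Automorphic.CartanUnique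
  Literature.NumberTheory.Automorphic.SymplecticCartan Literature.NumberTheory.Automorphic.heckeAlgebra

/-! ## §0 The coefficient table `c_{m,k}` and its recursion -/

/-- **The coefficients of `ξ̂_H(φ_m)` in the `U(1,1)` Hecke basis**: `c_{m,m} = (−q)^m`, `c_{m,k} = (q² − 1)(−q)^k q^{2(m−1−k)}` for `k < m`, and `0` for `k > m`
(`q = q_v`, the square root of the residue cardinality `Q = #𝓀[E_w]` at an inert place); e.g. `ξ̂_H(φ₁) = −q φ′₁ + (q² − 1)·1`.
[cite: Rogawski1990, §4.9 Prop. 4.9.1 (b), p. 55] [cite: Macdonald1971, Ch. V §3] -/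
def xiHCoeff (q m k : ℕ) : ℂ :=
  if k = m then (-(q : ℂ)) ^ m else if k < m then ((q : ℂ) ^ 2 - 1) * (-(q : ℂ)) ^ k * (q : ℂ) ^ (2 * (m - 1 - k)) else 0

/-- Kill-check: the diagonal coefficient `c_{m,m} = (−q)^m`. [cite: Macdonald1971, Ch. V §3] -/
theorem xiHCoeff_self (q m : ℕ) : xiHCoeff q m m = (-(q : ℂ)) ^ m := by
  simp [xiHCoeff]

/-- Kill-check: below the diagonal `c_{m,k} = (q² − 1)(−q)^k q^{2(m−1−k)}` (`k < m`). [cite: Macdonald1971, Ch. V §3] -/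
theorem xiHCoeff_of_lt {q m k : ℕ} (h : k < m) :
    xiHCoeff q m k = ((q : ℂ) ^ 2 - 1) * (-(q : ℂ)) ^ k * (q : ℂ) ^ (2 * (m - 1 - k)) := by
  simp [xiHCoeff, h.ne, h]

/-- Kill-check: above the diagonal the coefficients vanish (`ξ̂_H(φ_m)` is supported on `φ′_0, …, φ′_m`). [cite: Macdonald1971, Ch. V §3] -/
theorem xiHCoeff_of_gt {q m k : ℕ} (h : m < k) : xiHCoeff q m k = 0 := by
  simp [xiHCoeff, h.ne', not_lt.mpr h.le]

/-- Kill-check `m = 1`: `c_{1,1} = −q` and `c_{1,0} = q² − 1`, i.e. `ξ̂_H(φ₁) = −q φ′₁ + (q² − 1)·1`. [cite: Rogawski1990, §4.9 Prop. 4.9.1 (b), p. 55] -/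
theorem xiHCoeff_one (q : ℕ) : xiHCoeff q 1 1 = -(q : ℂ) ∧ xiHCoeff q 1 0 = (q : ℂ) ^ 2 - 1 := by
  refine ⟨by rw [xiHCoeff_self, pow_one], ?_⟩
  rw [xiHCoeff_of_lt Nat.one_pos]
  simp

/-- The recursion below the diagonal: `c_{m+1,k} = q² c_{m,k}` (`k < m`). [cite: Macdonald1971, Ch. V §3] -/
theorem xiHCoeff_succ_of_lt {q m k : ℕ} (h : k < m) : xiHCoeff q (m + 1) k = (q : ℂ) * q * xiHCoeff q m k := by
  rw [xiHCoeff_of_lt h, xiHCoeff_of_lt (Nat.lt_succ_of_lt h)]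
  have e : m + 1 - 1 - k = (m - 1 - k) + 1 := by omega
  rw [e]
  ring

/-- The recursion on the first sub-diagonal: `c_{m+1,m} = (q² − 1)(−q)^m = q² c_{m,m} + (−1)^{m+1} q^m`. [cite: Macdonald1971, Ch. V §3] -/
theorem xiHCoeff_succ_self (q m : ℕ) :
    xiHCoeff q (m + 1) m = (q : ℂ) * q * xiHCoeff q m m + (-1 : ℂ) ^ (m + 1) * (q : ℂ) ^ m := by
  rw [xiHCoeff_of_lt (Nat.lt_succ_self m), xiHCoeff_self, neg_pow, pow_succ]
  have e : 2 * (m + 1 - 1 - m) = 0 := by omega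
  rw [e, pow_zero]
  ring

/-! ## §1 Telescoping in any `ℂ`-module -/

/-- **Telescoping** (any `ℂ`-module `M`): if `ξ 0 = φ 0` and `ξ m − Q ξ (m−1) = (−1)^m (q^m φ m + q^{m−1} φ (m−1))` for all `m ≥ 1` with `Q = q·q`, then
`ξ m = Σ_{k ≤ m} c_{m,k} φ k` with `c = xiHCoeff q` (induction on `m`; the step is the coefficient recursion `xiHCoeff_succ_of_lt` ∕ `xiHCoeff_succ_self` ∕
`xiHCoeff_self`). [cite: Macdonald1971, Ch. V §3] [cite: CartierCorvallis1979, §IV (4.2)–(4.4)] -/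
theorem eq_sum_xiHCoeff_smul_of_step {M : Type*} [AddCommGroup M] [Module ℂ M] (q : ℕ) (Q : ℂ) (ξ φ : ℕ → M)
    (hQ : Q = (q : ℂ) * q) (h0 : ξ 0 = φ 0)
    (hstep : ∀ m : ℕ, 1 ≤ m →
      ξ m - Q • ξ (m - 1) = ((-1 : ℂ) ^ m * (q : ℂ) ^ m) • φ m + ((-1 : ℂ) ^ m * (q : ℂ) ^ (m - 1)) • φ (m - 1))
    (m : ℕ) : ξ m = ∑ k ∈ Finset.range (m + 1), xiHCoeff q m k • φ k := by
  induction m with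
  | zero => rw [Finset.sum_range_one, xiHCoeff_self, pow_zero, one_smul, h0]
  | succ n ih =>
    have hs := hstep (n + 1) (Nat.succ_pos n)
    simp only [Nat.add_sub_cancel] at hs
    rw [sub_eq_iff_eq_add] at hs
    have hcN : xiHCoeff q (n + 1) (n + 1) = (-1 : ℂ) ^ (n + 1) * (q : ℂ) ^ (n + 1) := by rw [xiHCoeff_self, neg_pow]
    have hcn : xiHCoeff q (n + 1) n = Q * xiHCoeff q n n + (-1 : ℂ) ^ (n + 1) * (q : ℂ) ^ n := by rw [xiHCoeff_succ_self, hQ]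
    have e1 : ∑ k ∈ Finset.range n, Q • (xiHCoeff q n k • φ k) = ∑ k ∈ Finset.range n, xiHCoeff q (n + 1) k • φ k :=
      Finset.sum_congr rfl (fun k hk => by rw [smul_smul, xiHCoeff_succ_of_lt (Finset.mem_range.mp hk), hQ])
    rw [hs, ih, Finset.smul_sum]
    simp only [Finset.sum_range_succ]
    rw [e1, hcN, hcn, add_smul, smul_smul]
    abel

section Adic

open NumberField IsDedekindDomain Literature.NumberTheory.Automorphic.UnitaryGroup
open Summit.HodgeConjecture.HodgeConjecture.Cruxes.HLiu418.K2LiuRankOneHeckeCellsTwo (rev_vecOne)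

variable {F E : Type} [Field F] [NumberField F] [Field E] [NumberField E] [Algebra F E] [Algebra.IsQuadraticExtension F E]
  (c : E ≃ₐ[F] E) (hc1 : c ≠ 1) (v : HeightOneSpectrum (𝓞 F)) (w : PlacesOver E v) (hw : c • w.1 = w.1)
  (hv : Algebra.IsUnramifiedIn (𝓞 E) v.asIdeal)

/-! ## §2 The closed form in `ℋ(U(1,1)_w)` at an inert unramified place -/

-- (as in ★ `R90S6SatakeGraphPartner` ∕ ★ H1: the `heckeAlgebra` carrier at `E_w` meets the generic module lemma §1 only through a costly
--  instance-path unification — no search explosion, no `decide`; hence the raised heartbeat budgets)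
set_option synthInstance.maxHeartbeats 400000 in
set_option maxHeartbeats 1600000 in
/-- **`ξ̂_H(φ_m)` IN THE `U(1,1)` HECKE BASIS: `ξ̂_H(φ_m) = Σ_{k ≤ m} c_{m,k} φ′_k`, `c_{m,k} = xiHCoeff q_v m k`** (`φ_m = 1_{K₀ t_wᵐ K₀}`, `t_w = hd_w.torusGen`,
`hd_w = unramifiedLocalConjDatum_localConjUniformizer …`; `φ′_k = 1_{K₀ t′ᵏ K₀}`, `t′ = diag(ϖ_w, ϖ_w⁻¹)`; `q_v = Nat.sqrt #𝓀[E_w]`) at an inert unramified place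
`w ∣ v`: §1 applied to ★ H1 `satakeGraphPartner_torusGen_pow_step` and `ξ̂_H(φ_0) = ξ̂_H(1) = 1 = φ′_0` (★ `doubleCosetOperator_one`).
[cite: Rogawski1990, §4.9 Prop. 4.9.1 (b), p. 55] [cite: Macdonald1971, Ch. V §3] [cite: CartierCorvallis1979, §IV (4.2)–(4.4), Cor. 4.2] -/
theorem satakeGraphPartnerAlgHom_doubleCosetOperator_torusGen_pow (m : ℕ) :
    haveI := isHeckeTriple_unitaryInt_adicCompletion c v w hw ((StdForm.antidiagonal 3).over (w.1.adicCompletion E))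
    haveI := isHeckeTriple_unitaryInt_adicCompletion c v w hw ((StdForm.antidiagonal 2).over (w.1.adicCompletion E))
    satakeGraphPartnerAlgHom c hc1 v w hw hv
        (doubleCosetOperator (unitaryInt (galAdicCompletionMap (L := E) c hw) ((StdForm.antidiagonal 3).over (w.1.adicCompletion E)))
          ((unramifiedLocalConjDatum_localConjUniformizer c hc1 v w hw hv).torusGen ^ m)) =
      ∑ k ∈ Finset.range (m + 1), xiHCoeff (Nat.sqrt (Nat.card 𝓀[w.1.adicCompletion E])) m k •
        doubleCosetOperator (unitaryInt (galAdicCompletionMap (L := E) c hw) ((StdForm.antidiagonal 2).over (w.1.adicCompletion E)))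
          ((⟨zpowDiagGL (uniformizer_ne_zero (unramifiedLocalConjDatum_localConjUniformizer c hc1 v w hw hv).vϖ) ![(1 : ℤ), -1],
            zpowDiagGL_mem_unitaryGroupOfForm (unramifiedLocalConjDatum_localConjUniformizer c hc1 v w hw hv).σϖ _ rev_vecOne⟩ :
            ↥(unitaryGroupOfForm (galAdicCompletionMap (L := E) c hw) ((StdForm.antidiagonal 2).over (w.1.adicCompletion E)))) ^ k) := by
  haveI := Literature.NumberTheory.Automorphic.finite_residueField_adicCompletion E w.1
  haveI := isHeckeTriple_unitaryInt_adicCompletion c v w hw ((StdForm.antidiagonal 3).over (w.1.adicCompletion E))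
  haveI := isHeckeTriple_unitaryInt_adicCompletion c v w hw ((StdForm.antidiagonal 2).over (w.1.adicCompletion E))
  have hσ : ∃ x : w.1.adicCompletion E, galAdicCompletionMap (L := E) c hw x ≠ x := exists_galAdicCompletionMap_ne c hc1 v w hw
  refine eq_sum_xiHCoeff_smul_of_step (Nat.sqrt (Nat.card 𝓀[w.1.adicCompletion E])) ((Nat.card 𝓀[w.1.adicCompletion E] : ℕ) : ℂ)
    (fun m => satakeGraphPartnerAlgHom c hc1 v w hw hv
      (doubleCosetOperator (unitaryInt (galAdicCompletionMap (L := E) c hw) ((StdForm.antidiagonal 3).over (w.1.adicCompletion E)))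
        ((unramifiedLocalConjDatum_localConjUniformizer c hc1 v w hw hv).torusGen ^ m)))
    (fun k => doubleCosetOperator (unitaryInt (galAdicCompletionMap (L := E) c hw) ((StdForm.antidiagonal 2).over (w.1.adicCompletion E)))
      ((⟨zpowDiagGL (uniformizer_ne_zero (unramifiedLocalConjDatum_localConjUniformizer c hc1 v w hw hv).vϖ) ![(1 : ℤ), -1],
        zpowDiagGL_mem_unitaryGroupOfForm (unramifiedLocalConjDatum_localConjUniformizer c hc1 v w hw hv).σϖ _ rev_vecOne⟩ :
        ↥(unitaryGroupOfForm (galAdicCompletionMap (L := E) c hw) ((StdForm.antidiagonal 2).over (w.1.adicCompletion E)))) ^ k))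
    (natCast_card_residueField_eq_sqrt_mul_sqrt (R := ℂ) (unramifiedLocalConjDatum_localConjUniformizer c hc1 v w hw hv) hσ) ?_
    (fun n hn => satakeGraphPartner_torusGen_pow_step c hc1 v w hw hv hn) m
  -- `ξ̂_H(φ_0) = ξ̂_H(1) = 1 = φ′_0`
  rw [pow_zero, pow_zero, doubleCosetOperator_one, doubleCosetOperator_one, map_one]

end Adic

end Summit.HodgeConjecture.HodgeConjecture.R90.S6

end
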